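import Mathlib
import Summits.ResolutionOfSingularities.ResolutionOfSingularities.Theorems.RadicialJungCleanModelsCleanPatchingPrincipalization
import Literature.AlgebraicGeometry.Resolution.BadCurveInduction
import HarnessLib

/-!
# Route `RadicialJung`, crux `CleanModels` (stmt-ResolutionOfSingularities-15917), line `Sketch` rev 14, stub 4b
# `stub_cleanTwoModelPatching3`: Zariski–Piltant patching for `P_clean`, Step 2 (making `M₂ ⋯→ M₁` a morphism)

Kernel transfer, part 2: the `P_clean` twin of `ProjModel.exists_hom_regLe_isIso_of_regPrincipalization`
(`Literature/AlgebraicGeometry/Resolution/PatchingMorphismStep.lean`; Piltant 2013, proof of Prop. 5.1, Step 2 with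
Axiom 4 (iii)).  The regular locus `Reg M₂` of the printed step is replaced by an arbitrary open `U ⊆ M₂` all of whose
points are clean-regular for the `K^p`-line of `g₀` (`ModelCleanRegAt`); Piltant's Axiom 4 on `U` is the hypothesis
`hT4` of the stub (Cossart–Piltant Prop. 4.4 keeping cleanness) through `exists_cleanExtension`
(`…CleanPatchingPrincipalization.lean`); «regular upstairs over `U`» becomes «clean-regular upstairs over `U`», read
on the modification model through `modelCleanRegAt_ofModification_iff` and moved to the join `J(N₂, M₁)` along the
local isomorphism `J(N₂, M₁) → N₂` over the open of definition (`ModelCleanRegAt.of_isIso_morphismRestrict`).  The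
base ideal, the open of definition, the join and the isomorphism loci are the `P`-independent parts of the printed
proof and are used verbatim.

* `exists_hom_cleanLe_isIso` — Step 2 for `P_clean` with the isomorphism locus of `N₂ → M₂`.

All PROVED (modulo the hypothesis `hT4`); nothing here proves resolution in characteristic `p`.
-/

noncomputable section

set_option linter.dupNamespace false -- mandated namespace of this single-conjunct summit

open CategoryTheory CategoryTheory.Limits AlgebraicGeometry TopologicalSpace IsLocalRing
open Literature.AlgebraicGeometry.Resolution Literature.AlgebraicGeometry.Motives
open Literature.AlgebraicGeometry.Resolution.ProjModel
open MvPolynomial HomogeneousLocalization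

namespace Summit.ResolutionOfSingularities.ResolutionOfSingularities.Theorems.RadicialJung.CleanModels

attribute [local instance] MvPolynomial.gradedAlgebra

variable {p : ℕ} {k K : Type} [Field k] [Field K] [Algebra k K]

/-- **Zariski–Piltant patching for `P_clean`, Step 2, with the isomorphism locus** (the `P_clean` twin of
`ProjModel.exists_hom_regLe_isIso_of_regPrincipalization`; Piltant 2013, proof of Prop. 5.1, Step 2, and Axiom 4
(iii)): for a closed `k`-immersion `ι₁ : M₁ ↪ ℙⁿ_k` with homogeneous coordinates `w ∈ Kⁿ⁺¹` of the generic point of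
`M₁` and an open `U ⊆ M₂` of clean-regular points (for the `K^p`-line of `g₀`; `trdeg_k K = 3`, `char k = p`),
assuming `hT4` there is a projective model `N₂` with a morphism of models `ψ : N₂ → M₂` such that, for the join
`N = J(N₂, M₁)` (which dominates `M₁` and `M₂`): every point of `N` over `U` is clean-regular; and `ψ` is an
isomorphism over every open of `M₂` missing the closure of the set of points of indeterminacy IN `U` of the rational
map `M₂ ⋯→ M₁` (`(w₀ : … : wₙ)` read in `K(M₂) ≅ K`). [cite: Piltant2013, Prop. 5.1 (proof, Step 2); §2 Axiom 4 (iii)] -/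
theorem exists_hom_cleanLe_isIso
    (hT4 : ∀ (p : ℕ), p.Prime → ∀ (S : Scheme.{0}) [IsIntegral S] [IsNoetherian S],
      CharP S.functionField p → Scheme.IsRegular S → Scheme.IsExcellent S → topologicalKrullDim S = 3 →
      ∀ G : S.functionField, (∀ s : S, CleanRegAt p (algebraMap (S.presheaf.stalk s) S.functionField) G) →
      ∀ J : S.IdealSheafData, J ≠ ⊥ →
      ∃ (S' : Scheme.{0}) (σ : S' ⟶ S) (_ : IsIntegral S') (_ : IsDominant σ),
      IsRegularCentreBlowupSeq σ J ∧ IsLocallyPrincipal (J.comap σ) ∧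
      ∀ s' : S', CleanRegAt p (algebraMap (S'.presheaf.stalk s') S'.functionField) (RatFn.functionFieldMap σ G))
    (hp : p.Prime) [CharP k p] (htr : Algebra.trdeg k K = 3) (g₀ : K) (M₁ M₂ : ProjModel k K) {n : ℕ}
    (ι₁ : M₁.X ⟶ Proj (Segre.grading (Fin (n + 1)) k)) [IsClosedImmersion ι₁]
    (hι₁w : ι₁ ≫ Segre.toSpec (Fin (n + 1)) k = M₁.π) (w : Fin (n + 1) → K) (hw : w ≠ 0)
    (hPw_left : M₁.gen ≫ ι₁ = (ProjectiveSpace.pointOfVec k w hw).left)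
    (U : M₂.X.Opens) (hU : ∀ x ∈ U, ModelCleanRegAt p g₀ M₂ x) :
    ∃ (N₂ : ProjModel k K) (ψ : N₂.Hom M₂),
      (∀ y : (join N₂ M₁).X, ((joinFst N₂ M₁).comp ψ).f y ∈ U → ModelCleanRegAt p g₀ (join N₂ M₁) y) ∧
      (∀ V : M₂.X.Opens, Disjoint (V : Set M₂.X)
          (closure ({m | ¬ IsDefinedAt (fun l => M₂.funFieldAlgEquiv.symm (w l)) m} ∩ (U : Set M₂.X))) →
        IsIso (ψ.f ∣_ V)) := by
  classical
  /- (0) the empty open: `N₂ = M₂` -/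
  by_cases hUne : ¬ (U : Set M₂.X).Nonempty
  · refine ⟨M₂, ⟨𝟙 M₂.X, Category.id_comp _, Category.comp_id _⟩, fun y hy => ?_, fun V _ => ?_⟩
    · exact absurd ⟨_, hy⟩ hUne
    · change IsIso ((𝟙 M₂.X) ∣_ V)
      infer_instance
  push Not at hUne
  /- (2) the rational map `M₂ ⋯→ ℙⁿ_k` given by `w` read in `K(M₂) ≅ K` -/
  let z : Fin (n + 1) → M₂.X.functionField := fun l => M₂.funFieldAlgEquiv.symm (w l)
  have hz : z ≠ 0 := ProjectiveSpace.algHom_comp_ne_zero M₂.funFieldAlgEquiv.symm.toAlgHom hw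
  have hz' : ∃ i, z i ≠ 0 := by
    by_contra h
    push Not at h
    exact hz (funext h)
  /- (3) the open subscheme `U` (integral) -/
  haveI : Nonempty (U : Scheme.{0}) := hUne.to_subtype
  haveI hintU : IsIntegral (U : Scheme.{0}) := isIntegral_of_isOpenImmersion U.ι
  /- (4) the base ideal of the rational map, restricted to `U`, is non-zero -/
  let J : (U : Scheme.{0}).IdealSheafData := (baseIdeal z).comap U.ι
  have hJ : J ≠ ⊥ := by
    intro hbot
    let y : (U : Scheme.{0}) := Classical.arbitrary _
    have h1 : stalkIdeal J y = ⊥ := by rw [hbot, stalkIdeal_bot]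
    rw [stalkIdeal_comap_of_isOpenImmersion] at h1
    obtain ⟨b, hb, hb0⟩ := (Submodule.ne_bot_iff _).mp (stalkIdeal_baseIdeal_ne_bot hz' (U.ι y))
    apply hb0
    have hb' : (U.ι.stalkMap y).hom b ∈
        (stalkIdeal (baseIdeal z) (U.ι y)).map (U.ι.stalkMap y).hom := Ideal.mem_map_of_mem _ hb
    rw [h1, Ideal.mem_bot] at hb'
    exact (asIso (U.ι.stalkMap y)).commRingCatIsoToRingEquiv.injective
      (hb'.trans (map_zero _).symm)
  /- (5) principalize on `U` (Axiom 4 for `P_clean`) and extend to `M₂`, keeping cleanness -/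
  obtain ⟨S', X', σ, ρ, j', hintS', hint', hdomρ, hj', hσ, hprinc, hpb, hprop, hbir, hproj₂, hover, hisoP, hclean⟩ :=
    exists_cleanExtension hT4 hp htr g₀ M₂ U hU hUne J hJ
  haveI := hj'
  haveI := hint'
  haveI := hprop
  haveI := hisoP
  haveI := hintS'
  haveI : IsLocallyNoetherian X' := LocallyOfFiniteType.isLocallyNoetherian ρ
  /- (6) `X'` as a projective model `N₂` dominating `M₂`, clean-regular over `U` -/
  obtain ⟨U₀, hU₀, hiso⟩ := M₂.exists_nonempty_isIso_morphismRestrict hbir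
  haveI := hiso
  let N₂ : ProjModel k K := ofModification M₂ ρ U₀ hU₀ hproj₂
  let ψ : N₂.Hom M₂ := ofModificationHom M₂ ρ U₀ hU₀ hproj₂
  have hψf : ψ.f = ρ := rfl
  have hcleanX' : ∀ y : X', ρ y ∈ (U : Set M₂.X) → ModelCleanRegAt p g₀ N₂ y := by
    intro y hy
    obtain ⟨s', rfl⟩ := hover y (by rwa [Scheme.Opens.range_ι])
    exact (modelCleanRegAt_ofModification_iff M₂ ρ U₀ hU₀ hproj₂ (j' s')).mpr (hclean s')
  /- (7) the transported rational map `z'` on `X'` is defined over `j'(S') = ρ⁻¹(U)` -/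
  let z' : Fin (n + 1) → X'.functionField := fun l => RatFn.functionFieldMap ρ (z l)
  have hz'eq : z' = fun l => N₂.funFieldAlgEquiv.symm (w l) :=
    funext fun l => functionFieldMap_funFieldIso_inv ψ (w l)
  have hdef' : ∀ s' : S', IsDefinedAt z' (j' s') := by
    intro s'
    refine isDefinedAt_of_isLocallyPrincipalAt_comap ρ hz'
      (isLocallyPrincipalAt_of_comap_isOpenImmersion j' _ ?_)
    have h := hprinc s'
    have hJσ : J.comap σ = ((baseIdeal z).comap ρ).comap j' := by
      change ((baseIdeal z).comap U.ι).comap σ = _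
      rw [← Scheme.IdealSheafData.comap_comp, ← Scheme.IdealSheafData.comap_comp, hpb.w]
    rwa [hJσ] at h
  /- (8) the open `W` of definition of `z'`, containing `j'(S')`; the join is `X'` over it -/
  have hz'' : ∃ i, z' i ≠ 0 := by
    obtain ⟨i, hi⟩ := hz'
    exact ⟨i, (map_ne_zero _).mpr hi⟩
  let W : X'.Opens := ⟨{y | IsDefinedAt z' y}, by
    have h := (isClosed_setOf_not_isDefinedAt hz'').isOpen_compl
    rwa [Set.compl_setOf, funext fun x => propext not_not] at h⟩
  have hWne : (W : Set X').Nonempty := ⟨j' (Classical.arbitrary S'), hdef' _⟩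
  have hWdef : ∀ y ∈ W, IsDefinedAt (fun l => N₂.funFieldAlgEquiv.symm (w l)) y :=
    fun y hy => by rw [← hz'eq]; exact hy
  have hisoW : IsIso ((joinFst N₂ M₁).f ∣_ W) :=
    isIso_joinFst_morphismRestrict_of_isDefinedAt N₂ M₁ ι₁ hι₁w w hw hPw_left W hWne hWdef
  /- (9) `U.ι(F)`, `F` the non-locally-principal locus of `J`, is the set of points of indeterminacy in `U` -/
  have hF : U.ι '' (nonPrincipalLocus J : Set U) = {m : M₂.X | ¬ IsDefinedAt z m} ∩ (U : Set M₂.X) := by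
    ext m
    constructor
    · rintro ⟨u, hu, rfl⟩
      exact ⟨fun hdef => hu ((isLocallyPrincipalAt_baseIdeal hdef).comap U.ι), by
        rw [Scheme.Opens.ι_apply]; exact u.2⟩
    · rintro ⟨hm, hmU⟩
      refine ⟨⟨m, hmU⟩, fun hu => hm ?_, rfl⟩
      exact (isDefinedAt_iff_isLocallyPrincipalAt (z := z) hz').mpr
        (isLocallyPrincipalAt_of_comap_isOpenImmersion U.ι _ hu)
  refine ⟨N₂, ψ, fun y hy => ?_, fun V hV => ?_⟩
  /- (10) cleanness over `U` -/
  · rw [Hom.comp_f, Scheme.Hom.comp_apply, hψf] at hy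
    have hyW : (joinFst N₂ M₁).f y ∈ W := by
      obtain ⟨s', hs'⟩ := hover _ (by rw [Scheme.Opens.range_ι]; exact hy)
      change IsDefinedAt z' ((joinFst N₂ M₁).f y)
      rw [← hs']
      exact hdef' s'
    haveI := hisoW
    exact ModelCleanRegAt.of_isIso_morphismRestrict (joinFst N₂ M₁) W y hyW (hcleanX' _ hy)
  /- (11) `ψ = ρ` is an isomorphism over every open missing the closure of `U.ι(F)` -/
  · have hVP : V ≤ principalOpen U.ι J := by
      intro m hm hmem
      rw [coe_closureImage, hF] at hmem
      exact Set.disjoint_left.mp hV hm hmem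
    rw [hψf]
    exact isIso_morphismRestrict_of_le ρ hisoP hVP

end Summit.ResolutionOfSingularities.ResolutionOfSingularities.Theorems.RadicialJung.CleanModels

end
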